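import Mathlib
import Literature.NumberTheory.LFunctions.Zhang2022.SkeletonPartOne
import Literature.NumberTheory.LFunctions.Zhang2022.SkeletonPartTwo
import Literature.NumberTheory.LFunctions.LiouvilleSumClassicalBound
import Literature.NumberTheory.LFunctions.TuranLiouvilleCriterion
import HarnessLib

/-!
# Zhang (2022), rescue bed (D-0124 (3)) Tier E: the (A)-world EMULATION `χ ↦ λ` — coefficient-generic
# versions of the (A)-guarded sums, their instances at `χ` (regression) and at Liouville's `λ`

Topic `Literature/NumberTheory/LFunctions/Zhang2022` (Landau–Siegel audit tree; verdict-neutral).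
Y. Zhang, *Discrete mean estimates and the Landau–Siegel zero*, arXiv:2211.02515v1 (2022)
[Zhang2022LandauSiegel] — **an unrefereed manuscript under adjudication; nothing in this file asserts or
denies any of its claims, and nothing here is a claim about Landau–Siegel zeros.**

Purpose (LS rescue protocol, bed Tier E «declared (A)-emulation», rescue/BED.md §0.2 (H5)). Assumption (A)
(`L(1,χ) < 𝓛⁻²⁰²²`) is false for every real primitive character an engine can reach, so the manuscript's
(A)-guarded main-term calculus (Lemma 3.1 `Σν(n)²/n` small off squares, Lemma 5.7 `Σν(n)/n ≈ L′(1,χ)`,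
Lemma 8.2 `Σ_{m<x}χ(m)m^{β_j−1}(x/m)^{β_μ}log(x/m) = L′(1,χ)𝔣_{jμ}(x) + O(𝓛⁻⁶)`, the normaliser
`𝔞 = (6/π²)L′(1,χ)²∏_{q∣D}q/(q+1)`) cannot be exercised on genuine characters. The (A)-world's limit object is
a completely multiplicative `±1`-valued function with value `−1` at EVERY prime: Liouville's `λ`. Replacing `χ`
by `λ` gives computable data on which the calculus CAN be run at finite `P` (`1 ∗ λ = 1_□`, so `ν` is the
indicator of the squares; `L(s,χ) ↦ ζ(2s)/ζ(s)`, `L′(1,χ) ↦ ζ(2)`). This file gives those bed rows typed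
referents:

* coefficient-generic objects: `nuF f = 1 ∗ f`, the partial sums `nuSum f x = Σ_{n≤x} ν_f(n)/n`,
  `nuSqSum f N M = Σ_{N<n≤M} ν_f(n)²/n`, the Lemma 8.2 sum `sum82F f β γ y`, the normaliser
  `frakAOf L′ Q = (6/π²)L′²∏_{q∈Q} q/(q+1)`;
* REGRESSION at `f = χ`: `nuF (χ ·) = Skeleton.nu χ`, `sum82F (χ ·) …` is literally the sum inside
  `Skeleton.Lemma82`, `nuSqSum (χ ·) (D⁴) ⌊P²⌋` is the sum inside `Skeleton.Lemma31`, `frakAOf (Re L′(1,χ))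
  D.primeFactors = frakA χ` (all `rfl`);
* the EMULATION instances: `lam = λ` (Mathlib's `ArithmeticFunction.liouville`, cast to `ℂ`),
  `nuF lam n = 1_□(n)` (from the tree's `LiouvilleSum.sum_divisors_liouville`), `nuSum lam x = Σ_{k≤√x} 1/k²`,
  the surrogate `Llam w = ζ(2w)/ζ(w)` with `LSeries lam s = Llam s` (`Re s > 1`, the tree's
  `TuranLiouville.LSeries_liouville_mul_riemannZeta`), and the λ-world normaliser `frakAOf (π²/6) ∅ = π²/6`;
* bed-2's Tier-E display families (INBOX 2026-08-27T07:11:49Z): `mainTerm82With L′ β γ y = L′·𝔣` (Lemma 8.2's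
  right side, regression `lemma82_rhs_eq`), the exact residue term `resMainTerm82 L β γ y`, the Lemma 8.4 ratio
  `ratio84 L s β′ β″` and its (A)-form `ratio84A L′ s β′ β″`;
* (rev 2) the dictionary entry «`L′(1) ↦ ζ(2)`» as a kernel limit: `tendsto_Llam_div : L_λ(1+u)/u → ζ(2)` (`u → 0`);
* (rev 3) its SECOND ORDER: `Llam_div_eq` (`L_λ(1+u)/u = ζ(2+2u)/ζ₁(1+u)`, Mathlib's `riemannZeta₁`),
  `hasDerivAt_Llam_model` (derivative `2ζ′(2) − γζ(2)` at `0`), `tendsto_Llam_second_order`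
  (`(L_λ(1+u)/u − ζ(2))/u → 2ζ′(2) − γζ(2)`), `second_order_const_eq` (relative constant `2ζ′(2)/ζ(2) − γ`, the
  bed's pre-registered convergence-model constant).

A Tier-E bed row «Lemma 8.2 under λ at scale S» is `sum82F lam β γ y` against `mainTerm82With ζ(2) β γ y = ζ(2)·frakf β γ (log y)`
with the bed's pre-registered `β, γ` (at Zhang's scale `β = betaJ c′ D j`, `γ = betaMu D μ`). What such a row
finds is a statement about the CALCULUS or our TYPING, never about characters (BED §0.2 (H5)).
Pure definitions, `rfl`-regressions and one divisor-sum identity; no analytic content; no `instance`, no notation.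

## References

* Y. Zhang, arXiv:2211.02515v1 (2022), §2 (2.31), §3 Lemma 3.1, §5 Lemma 5.7, §8 Lemma 8.2.
  [cite: Zhang2022LandauSiegel, §§2, 3, 5, 8]
-/

noncomputable section

open Complex Real

namespace Literature.NumberTheory.LFunctions.Zhang2022.Repair.Bed

/-! ## Coefficient-generic objects -/

/-- `ν_f = 1 ∗ f`: `ν_f(n) = Σ_{d∣n} f(d)` for an arbitrary coefficient sequence `f` (the manuscript's
`ν = 1 ∗ χ`, §3 p. 6, with `χ` replaced by `f`). [cite: Zhang2022LandauSiegel, §3 p. 6] -/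
def nuF (f : ℕ → ℂ) (n : ℕ) : ℂ := ∑ d ∈ n.divisors, f d

/-- `Σ_{n≤x} ν_f(n)/n` (the Lemma 5.7-type first moment of `ν`, coefficient-generic).
[cite: Zhang2022LandauSiegel, §5 Lemma 5.7] -/
def nuSum (f : ℕ → ℂ) (x : ℕ) : ℂ := ∑ n ∈ Finset.Icc 1 x, nuF f n / (n : ℂ)

/-- `Σ_{N<n≤M} ν_f(n)²/n` (the Lemma 3.1 tail (3.2), coefficient-generic, general window).
[cite: Zhang2022LandauSiegel, §3 Lemma 3.1 (3.2)] -/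
def nuSqSum (f : ℕ → ℂ) (N M : ℕ) : ℂ := ∑ n ∈ Finset.Ioc N M, nuF f n ^ 2 / (n : ℂ)

/-- **The Lemma 8.2 sum with an arbitrary coefficient `f`**:
`Σ_{m<y} f(m) m^{−(1−β)} (y/m)^γ log(y/m)` (printed with `f = χ`, `β = β_j`, `γ = β_μ`).
[cite: Zhang2022LandauSiegel, §8 Lemma 8.2] -/
def sum82F (f : ℕ → ℂ) (β γ : ℂ) (y : ℝ) : ℂ :=
  ∑ m ∈ Finset.Ico 1 ⌈y⌉₊, f m / (m : ℂ) ^ (1 - β) * ((y / m : ℝ) : ℂ) ^ γ * (Real.log (y / m) : ℂ)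

/-- **The normaliser with its inputs explicit**: `(6/π²)·L′²·∏_{q∈Q} q/(q+1)` ((2.31) with `L′(1,χ)` and the
prime set of `D` as arguments). [cite: Zhang2022LandauSiegel, §2 (2.31)] -/
def frakAOf (Lp : ℝ) (Q : Finset ℕ) : ℝ := 6 / π ^ 2 * Lp ^ 2 * ∏ q ∈ Q, ((q : ℝ) / (q + 1))

/-! ## Regression at `f = χ`: these ARE the manuscript's objects -/

section Regression

variable {D : ℕ} (χ : DirichletCharacter ℂ D)

/-- `ν_χ` is the skeleton's `ν = 1 ∗ χ` (`Skeleton.nu χ = divisorSumChar χ`). [cite: Zhang2022LandauSiegel, §3 p. 6] -/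
theorem nuF_chi : nuF (fun n => χ (n : ZMod D)) = Skeleton.nu χ := rfl

/-- The Lemma 8.2 sum at `f = χ` is literally the sum inside `Skeleton.Lemma82` (for any shifts `β, γ`; there
`β = betaJ c′ D j`, `γ = betaMu D μ`). [cite: Zhang2022LandauSiegel, §8 Lemma 8.2] -/
theorem sum82F_chi (β γ : ℂ) (y : ℝ) :
    sum82F (fun m => χ (m : ZMod D)) β γ y =
      ∑ m ∈ Finset.Ico 1 ⌈y⌉₊, χ (m : ZMod D) / (m : ℂ) ^ (1 - β) * ((y / m : ℝ) : ℂ) ^ γ *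
        (Real.log (y / m) : ℂ) := rfl

/-- `Skeleton.Lemma82 c′` restated through `sum82F` (definitional unfolding, so a bed row and the node speak
about the same sum). [cite: Zhang2022LandauSiegel, §8 Lemma 8.2] -/
theorem lemma82_iff_sum82F (c' : ℝ) :
    Skeleton.Lemma82 c' ↔
      ∃ C : ℝ, Skeleton.ForAllLarge fun D _ χ => Skeleton.AssumptionA D χ →
        ∀ j ∈ ({1, 2, 3} : Finset ℕ), ∀ μ ∈ ({6, 7} : Finset ℕ), ∀ y : ℝ,
          Skeleton.bigT D < y → y < Skeleton.bigP D →
            ‖sum82F (fun m => χ (m : ZMod D)) (Skeleton.betaJ c' D j) (Skeleton.betaMu D μ) y -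
                deriv χ.LFunction 1 * Skeleton.frakfW c' D j μ y‖ ≤ C * (Skeleton.ell D ^ 6)⁻¹ :=
  Iff.rfl

/-- The Lemma 3.1 tail at `f = χ` is literally the sum inside `Skeleton.Lemma31`
(`Σ_{D⁴<n≤P²} ν(n)²/n`). [cite: Zhang2022LandauSiegel, §3 Lemma 3.1 (3.2)] -/
theorem nuSqSum_chi (N M : ℕ) :
    nuSqSum (fun n => χ (n : ZMod D)) N M = ∑ n ∈ Finset.Ioc N M, Skeleton.nu χ n ^ 2 / (n : ℂ) := rfl

/-- `Skeleton.Lemma31` restated through `nuSqSum`. [cite: Zhang2022LandauSiegel, §3 Lemma 3.1] -/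
theorem lemma31_iff_nuSqSum :
    Skeleton.Lemma31 ↔
      ∃ C : ℝ, Skeleton.ForAllLarge fun D _ χ => Skeleton.AssumptionA D χ →
        ‖nuSqSum (fun n => χ (n : ZMod D)) (D ^ 4) ⌊Skeleton.bigP D ^ 2⌋₊‖ ≤ C / Skeleton.ell D ^ 2011 :=
  Iff.rfl

variable [NeZero D] in
/-- `𝔞` with its inputs explicit IS the skeleton's `𝔞` at `(Re L′(1,χ), primeFactors D)`.
[cite: Zhang2022LandauSiegel, §2 (2.31)] -/
theorem frakAOf_chi : frakAOf (deriv χ.LFunction 1).re D.primeFactors = Skeleton.frakA χ := rfl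

end Regression

/-! ## The emulation `χ ↦ λ` -/

/-- **Liouville's `λ` as a complex coefficient sequence** (Mathlib's `ArithmeticFunction.liouville`:
`λ(n) = (−1)^{Ω(n)}`, `λ(0) = 0`): the (A)-world's limit object — completely multiplicative, `−1` at every prime.
[cite: Titchmarsh1986, §1.2 (1.2.11)] -/
def lam (n : ℕ) : ℂ := (ArithmeticFunction.liouville n : ℂ)

/-- `λ(p) = −1` at every prime (Titchmarsh §1.2: `λ(n) = (−1)^r`, `r` the number of prime factors with
multiplicity). [cite: Titchmarsh1986, §1.2 (1.2.11)] -/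
theorem lam_prime {p : ℕ} (hp : p.Prime) : lam p = -1 := by
  simp [lam, ArithmeticFunction.liouville_apply hp.ne_zero, ArithmeticFunction.cardFactors_apply_prime hp]

/-- `λ` is completely multiplicative: `λ(mn) = λ(m)λ(n)`. [cite: Titchmarsh1986, §1.2 (1.2.11)] -/
theorem lam_mul (m n : ℕ) : lam (m * n) = lam m * lam n := by
  simp [lam, ArithmeticFunction.liouville_apply_mul]

/-- **`ν_λ = 1 ∗ λ = 1_□`**: `Σ_{d∣n} λ(d) = [n is a square]` for `n ≠ 0` (the tree's
`LiouvilleSum.sum_divisors_liouville`) — the emulated `ν` is the indicator of the squares, the exact form of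
«`ν` is supported on squares» that (A) delivers approximately (§§3–5); Titchmarsh §1.2 after (1.2.11):
«`Σ_{d∣n} λ(d) = 1` or `0` according as `n` is or is not a square». [cite: Titchmarsh1986, §1.2 (1.2.11)] -/
theorem nuF_lam {n : ℕ} (hn : n ≠ 0) : nuF lam n = if IsSquare n then 1 else 0 := by
  unfold nuF lam
  rw [← Int.cast_sum, LiouvilleSum.sum_divisors_liouville hn]
  split_ifs <;> simp

/-- **The emulated first moment is the square-harmonic sum**: `Σ_{n≤x} ν_λ(n)/n = Σ_{k≤√x} 1/k²` — so the
λ-world «`Σν(n)/n → L′(1)`» limit is `ζ(2) = π²/6`, with tail exactly `Σ_{k>√x} 1/k²` (the convergence model a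
Tier-E row pre-registers). [cite: Zhang2022LandauSiegel, §5 Lemma 5.7] -/
theorem nuSum_lam (x : ℕ) : nuSum lam x = ∑ k ∈ Finset.Icc 1 (Nat.sqrt x), 1 / ((k : ℂ) ^ 2) := by
  unfold nuSum
  have h1 : ∀ n ∈ Finset.Icc 1 x, nuF lam n / (n : ℂ) = if IsSquare n then 1 / (n : ℂ) else 0 := by
    intro n hn
    have hn0 : n ≠ 0 := by have := (Finset.mem_Icc.mp hn).1; omega
    rw [nuF_lam hn0]
    split_ifs <;> simp
  rw [Finset.sum_congr rfl h1, ← Finset.sum_filter]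
  have himg : (Finset.Icc 1 x).filter IsSquare = (Finset.Icc 1 (Nat.sqrt x)).image (fun k => k * k) := by
    ext n
    simp only [Finset.mem_filter, Finset.mem_Icc, Finset.mem_image]
    constructor
    · rintro ⟨⟨hn1, hn2⟩, r, rfl⟩
      refine ⟨r, ⟨?_, Nat.le_sqrt.mpr hn2⟩, rfl⟩
      rcases Nat.eq_zero_or_pos r with h | h
      · subst h; simp at hn1
      · exact h
    · rintro ⟨k, ⟨hk1, hk2⟩, rfl⟩
      exact ⟨⟨Nat.mul_pos hk1 hk1, Nat.le_sqrt.mp hk2⟩, k, rfl⟩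
  rw [himg, Finset.sum_image (fun a _ b _ h => Nat.mul_self_inj.mp h)]
  refine Finset.sum_congr rfl fun k _ => ?_
  push_cast
  ring

/-- The λ-world normaliser: `L′(1) ↦ ζ(2) = π²/6`, no ramified primes, so `𝔞_λ = (6/π²)(π²/6)² = π²/6`.
[cite: Zhang2022LandauSiegel, §2 (2.31)] -/
theorem frakAOf_lambda : frakAOf (π ^ 2 / 6) ∅ = π ^ 2 / 6 := by
  have hπ : (π : ℝ) ≠ 0 := Real.pi_ne_zero
  simp only [frakAOf, Finset.prod_empty, mul_one]
  field_simp

/-! ## The surrogate `L`, the Lemma 8.2 main-term families, the Lemma 8.4 ratio (bed-2's Tier-E displays) -/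

/-- **The λ-world surrogate for `L(w,χ)`**: `L_λ(w) := ζ(2w)/ζ(w)` (so «`L(1) = 0`», «`L′(1) = ζ(2)`»;
Titchmarsh (1.2.11) `ζ(2s)/ζ(s) = Σ λ(n)n^{−s}`). [cite: Titchmarsh1986, §1.2 (1.2.11)] -/
def Llam (w : ℂ) : ℂ := riemannZeta (2 * w) / riemannZeta w

/-- `Σ λ(n)n^{−s} = ζ(2s)/ζ(s) = L_λ(s)` for `Re s > 1` (the tree's
`TuranLiouville.LSeries_liouville_mul_riemannZeta`, Titchmarsh (1.2.11)). [cite: Titchmarsh1986, §1.2 (1.2.11)] -/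
theorem LSeries_lam {s : ℂ} (hs : 1 < s.re) : LSeries lam s = Llam s := by
  have hζ : riemannZeta s ≠ 0 := riemannZeta_ne_zero_of_one_lt_re hs
  rw [Llam, eq_div_iff hζ]
  exact TuranLiouville.LSeries_liouville_mul_riemannZeta hs

/-- **Lemma 8.2's right side as a family in the «`L′(1)`» slot**: `mainTerm82With L′ β γ y := L′·𝔣(β,γ; log y)`
with the skeleton's `𝔣(β_j,β_μ;L) = (1 + (β_μ − β_j)L)e^{β_μ L}` (`Zhang2022.frakf`); instances `L′ = L′(1,χ_D)`
(printed) and `L′ = ζ(2)` (λ-world). [cite: Zhang2022LandauSiegel, §8 Lemma 8.2] -/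
def mainTerm82With (Lp1 β γ : ℂ) (y : ℝ) : ℂ := Lp1 * frakf β γ (Real.log y)

/-- Unfolded: `mainTerm82With L′ β γ y = L′·(1 + (γ − β)log y)·e^{γ log y}`. [cite: Zhang2022LandauSiegel, §8 Lemma 8.2] -/
theorem mainTerm82With_eq (Lp1 β γ : ℂ) (y : ℝ) :
    mainTerm82With Lp1 β γ y = Lp1 * ((1 + (γ - β) * (Real.log y : ℂ)) * cexp (γ * (Real.log y : ℂ))) := rfl

/-- With `y^γ` displayed: for `y > 0`, `mainTerm82With L′ β γ y = L′·(1 + (γ − β)log y)·y^γ`.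
[cite: Zhang2022LandauSiegel, §8 Lemma 8.2] -/
theorem mainTerm82With_eq_cpow (Lp1 β γ : ℂ) {y : ℝ} (hy : 0 < y) :
    mainTerm82With Lp1 β γ y = Lp1 * (1 + (γ - β) * (Real.log y : ℂ)) * (y : ℂ) ^ γ := by
  rw [mainTerm82With_eq, Complex.cpow_def_of_ne_zero (by exact_mod_cast hy.ne'), Complex.ofReal_log hy.le,
    mul_comm (Complex.log _) γ, mul_assoc]

/-- REGRESSION: the right side of `Skeleton.Lemma82` is `mainTerm82With (L′(1,χ)) (β_j) (β_μ)`.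
[cite: Zhang2022LandauSiegel, §8 Lemma 8.2] -/
theorem lemma82_rhs_eq {D : ℕ} [NeZero D] (χ : DirichletCharacter ℂ D) (c' : ℝ) (j μ : ℕ) (y : ℝ) :
    deriv χ.LFunction 1 * Skeleton.frakfW c' D j μ y =
      mainTerm82With (deriv χ.LFunction 1) (Skeleton.betaJ c' D j) (Skeleton.betaMu D μ) y := rfl

/-- **The EXACT residue main term in an arbitrary `L`**: `y^γ·(L′(1−β+γ) + L(1−β+γ)·log y)` — the pole
contribution before the (A)-linearisation `L(1+w) ≈ L′(1)w` (Lemma 5.8) turns it into `mainTerm82With (L′(1))`;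
instances `L = L(·,χ_D)` and `L = L_λ`. [cite: Zhang2022LandauSiegel, §8 Lemma 8.2 (proof)] -/
def resMainTerm82 (L : ℂ → ℂ) (β γ : ℂ) (y : ℝ) : ℂ :=
  (y : ℂ) ^ γ * (deriv L (1 - β + γ) + L (1 - β + γ) * (Real.log y : ℂ))

/-- **The Lemma 8.4 ratio display** `L(1+s+β′)L(1+s+β″)/L(1+s)` in an arbitrary `L`
(`β′, β″ = β_{j+1}, β_{j+2}`, indices mod 3). [cite: Zhang2022LandauSiegel, §8 Lemma 8.4 (proof)] -/
def ratio84 (L : ℂ → ℂ) (s β' β'' : ℂ) : ℂ := L (1 + s + β') * L (1 + s + β'') / L (1 + s)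

/-- **Its (A)-linearised form** `L′(1)·(s+β′)(s+β″)/s` (each factor replaced by `L′(1)·(argument − 1)`, Lemma 5.8).
[cite: Zhang2022LandauSiegel, §8 Lemma 8.4 (proof); §5 Lemma 5.8] -/
def ratio84A (Lp1 s β' β'' : ℂ) : ℂ := Lp1 * (s + β') * (s + β'') / s

/-! ## The λ-dictionary entry «`L′(1) ↦ ζ(2)`» as a kernel limit (rev 2)

`L_λ(w) = ζ(2w)/ζ(w)` has a simple zero at `w = 1` (simple pole of `ζ`), and `L_λ(1+u)/u → ζ(2)` as `u → 0`:
this is the exact content of the bed's pre-registration «`L′(1,χ) ↦ ζ(2)`» for the emulated Lemma 5.8 / 8.2 / 8.4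
main terms (`mainTerm82With (ζ 2)`, `ratio84A (ζ 2)`). -/

open Filter _root_.Topology in
/-- **`L_λ(1+u)/u → ζ(2)` as `u → 0` (`u ≠ 0`)** — the λ-world «`L′(1) = ζ(2)`»: from the residue
`(s−1)ζ(s) → 1` (Mathlib `riemannZeta_residue_one`) and continuity of `ζ` at `2`.
[cite: Titchmarsh1986, §1.2 (1.2.11)] -/
theorem tendsto_Llam_div : Tendsto (fun u : ℂ => Llam (1 + u) / u) (𝓝[≠] 0) (𝓝 (riemannZeta 2)) := by
  -- `u ↦ 1 + u` maps the punctured neighbourhood of `0` into that of `1`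
  have hmap : Tendsto (fun u : ℂ => 1 + u) (𝓝[≠] (0 : ℂ)) (𝓝[≠] 1) := by
    refine tendsto_nhdsWithin_of_tendsto_nhds_of_eventually_within _ ?_ ?_
    · have h : Continuous fun u : ℂ => 1 + u := by fun_prop
      have h0 := h.tendsto 0
      simp only [add_zero] at h0
      exact h0.mono_left nhdsWithin_le_nhds
    · filter_upwards [self_mem_nhdsWithin] with u hu
      simp only [Set.mem_compl_iff, Set.mem_singleton_iff, add_eq_left]
      exact hu
  -- `u · ζ(1+u) → 1`
  have hres : Tendsto (fun u : ℂ => u * riemannZeta (1 + u)) (𝓝[≠] 0) (𝓝 1) := by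
    have h := riemannZeta_residue_one.comp hmap
    refine h.congr' ?_
    filter_upwards [self_mem_nhdsWithin] with u _
    simp only [Function.comp_apply, add_sub_cancel_left]
  -- `ζ(2 + 2u) → ζ(2)`
  have hnum : Tendsto (fun u : ℂ => riemannZeta (2 * (1 + u))) (𝓝[≠] 0) (𝓝 (riemannZeta 2)) := by
    have hc : ContinuousAt riemannZeta 2 :=
      (differentiableAt_riemannZeta (by norm_num)).continuousAt
    have hlin : Tendsto (fun u : ℂ => 2 * (1 + u)) (𝓝 (0 : ℂ)) (𝓝 2) := by
      have h : Continuous fun u : ℂ => 2 * (1 + u) := by fun_prop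
      have h0 := h.tendsto 0
      simp only [add_zero, mul_one] at h0
      exact h0
    exact (hc.tendsto.comp hlin).mono_left nhdsWithin_le_nhds
  have hq := hnum.div hres one_ne_zero
  rw [div_one] at hq
  refine hq.congr' ?_
  filter_upwards [self_mem_nhdsWithin] with u _
  simp only [Pi.div_apply, Llam]
  rw [div_div, mul_comm (riemannZeta (1 + u)) u]

/-! ## The second-order term of the λ-dictionary (rev 3): `L_λ(1+u)/u = ζ(2) + (2ζ′(2) − γζ(2))·u + o(u)`

Away from `u = 0`, `L_λ(1+u)/u` is the holomorphic function `G(u) = ζ(2+2u)/ζ₁(1+u)` (Mathlib's `riemannZeta₁`, the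
completion of `(s−1)ζ(s)`: `ζ₁(1) = 1`, `ζ₁′(1) = γ`); hence the first-order relative deviation of the emulated
«`L(1+u) ≈ L′(1)·u`» (Lemma 5.8's linearisation) is `(2ζ′(2)/ζ(2) − γ)·u` — the convergence-model constant a Tier-E
row pre-registers (bed-2 spec bed2-E: `c = 2ζ′(2)/ζ(2) − γ`). -/

/-- For `u ≠ 0`: `L_λ(1+u)/u = ζ(2(1+u))/ζ₁(1+u)` (`ζ(s) = (s−1)⁻¹ζ₁(s)`, Mathlib `riemannZeta_eq_inv_sub_mul`).
[cite: Titchmarsh1986, §1.2 (1.2.11)] -/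
theorem Llam_div_eq {u : ℂ} (hu : u ≠ 0) :
    Llam (1 + u) / u = riemannZeta (2 * (1 + u)) / riemannZeta₁ (1 + u) := by
  unfold Llam
  have h1 : (1 : ℂ) + u ≠ 1 := by simpa using hu
  rw [riemannZeta_eq_inv_sub_mul h1, add_sub_cancel_left, div_div]
  congr 1
  field_simp

open Filter _root_.Topology in
/-- **The model function is differentiable at `0` with derivative `2ζ′(2) − γ·ζ(2)`**:
`d/du [ζ(2+2u)/ζ₁(1+u)]|_{u=0} = (2ζ′(2)·ζ₁(1) − ζ(2)·ζ₁′(1))/ζ₁(1)² = 2ζ′(2) − γζ(2)`.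
[cite: Titchmarsh1986, §1.2 (1.2.11)] -/
theorem hasDerivAt_Llam_model :
    HasDerivAt (fun u : ℂ => riemannZeta (2 * (1 + u)) / riemannZeta₁ (1 + u))
      (2 * deriv riemannZeta 2 - (Real.eulerMascheroniConstant : ℂ) * riemannZeta 2) 0 := by
  have h1 : HasDerivAt (fun u : ℂ => riemannZeta (2 * (1 + u))) (deriv riemannZeta 2 * 2) 0 := by
    have hζ : HasDerivAt riemannZeta (deriv riemannZeta 2) (2 * (1 + 0)) := by
      rw [show (2 : ℂ) * (1 + 0) = 2 by ring]
      exact (differentiableAt_riemannZeta (by norm_num)).hasDerivAt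
    have hlin : HasDerivAt (fun u : ℂ => 2 * (1 + u)) 2 0 := by
      simpa using ((hasDerivAt_id (0 : ℂ)).const_add 1).const_mul 2
    exact hζ.comp 0 hlin
  have h2 : HasDerivAt (fun u : ℂ => riemannZeta₁ (1 + u)) (Real.eulerMascheroniConstant : ℂ) 0 := by
    have hζ1 : HasDerivAt riemannZeta₁ (deriv riemannZeta₁ 1) ((1 : ℂ) + 0) := by
      rw [add_zero]
      exact differentiable_riemannZeta₁.differentiableAt.hasDerivAt
    rw [deriv_riemannZeta₁_one] at hζ1
    exact hζ1.comp_const_add 1 0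
  refine (h1.div h2 (by simp)).congr_deriv ?_
  rw [add_zero, mul_one, riemannZeta₁_one]
  ring

open Filter _root_.Topology in
/-- **Second order of the λ-dictionary**: `(L_λ(1+u)/u − ζ(2))/u → 2ζ′(2) − γζ(2)` as `u → 0` — i.e.
`L_λ(1+u) = ζ(2)u + (2ζ′(2) − γζ(2))u² + o(u²)`, relative constant `2ζ′(2)/ζ(2) − γ`.
[cite: Titchmarsh1986, §1.2 (1.2.11)] -/
theorem tendsto_Llam_second_order :
    Tendsto (fun u : ℂ => (Llam (1 + u) / u - riemannZeta 2) / u) (𝓝[≠] 0)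
      (𝓝 (2 * deriv riemannZeta 2 - (Real.eulerMascheroniConstant : ℂ) * riemannZeta 2)) := by
  have h := hasDerivAt_Llam_model.tendsto_slope_zero
  refine h.congr' ?_
  filter_upwards [self_mem_nhdsWithin] with u hu
  simp only [Set.mem_compl_iff, Set.mem_singleton_iff] at hu
  rw [zero_add, Llam_div_eq hu, smul_eq_mul]
  simp only [add_zero, mul_one, riemannZeta₁_one, div_one]
  ring

/-- The relative second-order constant: `2ζ′(2) − γζ(2) = ζ(2)·(2ζ′(2)/ζ(2) − γ)` (`ζ(2) = π²/6 ≠ 0`) — bed-2's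
pre-registered `c = 2ζ′(2)/ζ(2) − γ`. [cite: Titchmarsh1986, §1.2 (1.2.11)] -/
theorem second_order_const_eq :
    2 * deriv riemannZeta 2 - (Real.eulerMascheroniConstant : ℂ) * riemannZeta 2 =
      riemannZeta 2 * (2 * deriv riemannZeta 2 / riemannZeta 2 - Real.eulerMascheroniConstant) := by
  have hζ : riemannZeta 2 ≠ 0 := by
    rw [riemannZeta_two]
    exact div_ne_zero (pow_ne_zero 2 (by exact_mod_cast Real.pi_ne_zero)) (by norm_num)
  rw [mul_sub, mul_div_cancel₀ _ hζ]
  ring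

end Literature.NumberTheory.LFunctions.Zhang2022.Repair.Bed
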